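import Mathlib

/-!
# DiscMeanValue — the area mean value property of holomorphic functions on a disc, and the
`L²`-bound `|f(c)|² ≤ (πR²)⁻¹ ∫_{B(c,R)} |f|²`

Blind cell `pub-hodge-repro2`, seat p2 (Tier 5 kernel support: towards the finite-dimensionality
of the space of holomorphic weight-`k` forms on the compact Picard modular surface — the sup-norm
of a holomorphic function on a compact set is controlled by its `L²`-norm on a neighbourhood).

Mathlib has the CIRCLE mean value property (`DiffContOnCl.circleAverage`: the circle average of a
function holomorphic on a disc and continuous up to the boundary is its value at the centre). This
file integrates it in polar coordinates (`Complex.integral_comp_polarCoord_symm`) to the AREA mean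
value property `∫_{B(c,R)} f = πR² · f(c)`, and deduces by Cauchy–Schwarz
`‖f c‖² ≤ (πR²)⁻¹ ∫_{B(c,R)} ‖f‖²`. Mathlib only.
-/

namespace Summit.Ventures.HodgeRepro2.DiscMeanValue

open MeasureTheory Metric Real Set
open scoped Real

/-- The polar parametrisation around `c` is the circle map: `c + polarCoord.symm (r, θ)
= circleMap c r θ`. -/
theorem add_polarCoord_symm (c : ℂ) (p : ℝ × ℝ) :
    c + Complex.polarCoord.symm p = circleMap c p.1 p.2 := by
  rw [Complex.polarCoord_symm_apply, circleMap, Complex.exp_mul_I, Complex.ofReal_cos,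
    Complex.ofReal_sin]

variable {f : ℂ → ℂ} {c : ℂ} {R : ℝ}

/-- The integrand of the polar form of the disc integral is integrable on the box
`Ioo 0 R ×ˢ Ioo (-π) π`. -/
theorem integrableOn_polar (hf : DiffContOnCl ℂ f (ball c R)) (hR : 0 < R) :
    IntegrableOn (fun p : ℝ × ℝ => p.1 • f (circleMap c p.1 p.2))
      (Ioo 0 R ×ˢ Ioo (-π) π) volume := by
  have hcont : ContinuousOn f (closedBall c R) := by
    simpa [closure_ball c hR.ne'] using hf.continuousOn
  obtain ⟨M, hM⟩ := (isCompact_closedBall c R).exists_bound_of_continuousOn hcont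
  have hmeas : MeasurableSet (Ioo (0:ℝ) R ×ˢ Ioo (-π) π) := measurableSet_Ioo.prod measurableSet_Ioo
  have hcm : Continuous (fun p : ℝ × ℝ => circleMap c p.1 p.2) := by
    unfold circleMap
    fun_prop
  have hmaps : ∀ p ∈ Ioo (0:ℝ) R ×ˢ Ioo (-π) π, circleMap c p.1 p.2 ∈ closedBall c R := by
    intro p hp
    have h1 : 0 < p.1 := hp.1.1
    have h2 : p.1 < R := hp.1.2
    rw [mem_closedBall, dist_eq_norm, circleMap_sub_center, norm_circleMap_zero, abs_of_pos h1]
    exact h2.le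
  have hcf : ContinuousOn (fun p : ℝ × ℝ => p.1 • f (circleMap c p.1 p.2))
      (Ioo (0:ℝ) R ×ˢ Ioo (-π) π) := by
    refine ContinuousOn.smul continuous_fst.continuousOn ?_
    exact hcont.comp hcm.continuousOn hmaps
  have hfin : volume (Ioo (0:ℝ) R ×ˢ Ioo (-π) π) ≠ ⊤ := by
    rw [Measure.volume_eq_prod, Measure.prod_prod, Real.volume_Ioo, Real.volume_Ioo]
    exact ENNReal.mul_ne_top ENNReal.ofReal_ne_top ENNReal.ofReal_ne_top
  haveI : IsFiniteMeasure (volume.restrict (Ioo (0:ℝ) R ×ˢ Ioo (-π) π)) :=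
    isFiniteMeasure_restrict.mpr hfin
  refine memLp_one_iff_integrable.mp (MemLp.of_bound (hcf.aestronglyMeasurable hmeas) (R * M) ?_)
  refine ae_restrict_of_forall_mem hmeas fun p hp => ?_
  rw [norm_smul, Real.norm_eq_abs, abs_of_pos hp.1.1]
  exact mul_le_mul hp.1.2.le (hM _ (hmaps p hp)) (norm_nonneg _) hR.le

/-- The inner (angular) integral of the polar form: for `0 < r < R`,
`∫_{θ ∈ (-π, π)} f (circleMap c r θ) = 2π · f c` (the circle mean value property). -/
theorem integral_angle (hf : DiffContOnCl ℂ f (ball c R)) {r : ℝ} (hr : 0 < r) (hrR : r < R) :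
    ∫ θ in Ioo (-π) π, f (circleMap c r θ) = (2 * π : ℝ) • f c := by
  have hper : Function.Periodic (fun θ => f (circleMap c r θ)) (2 * π) :=
    (periodic_circleMap c r).comp f
  have h1 : ∫ θ in Ioo (-π) π, f (circleMap c r θ) = ∫ θ in (-π)..π, f (circleMap c r θ) := by
    rw [intervalIntegral.integral_of_le (by linarith [Real.pi_pos]), integral_Ioc_eq_integral_Ioo]
  have h2 : ∫ θ in (-π)..π, f (circleMap c r θ) = ∫ θ in (0:ℝ)..2 * π, f (circleMap c r θ) := by
    have h := hper.intervalIntegral_add_eq (-π) 0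
    rw [zero_add, show -π + 2 * π = π by ring] at h
    exact h
  have h3 : DiffContOnCl ℂ f (ball c |r|) := by
    rw [abs_of_pos hr]
    exact hf.mono (ball_subset_ball hrR.le)
  have h4 := h3.circleAverage
  rw [circleAverage_def] at h4
  rw [h1, h2, ← h4, smul_smul, mul_inv_cancel₀ (by positivity), one_smul]

/-- **The area mean value property**: for `f` holomorphic on the open disc `B(c, R)` and
continuous on the closed disc, `∫_{B(c,R)} f = πR² · f c`. -/
theorem integral_ball_eq_pi_smul (hf : DiffContOnCl ℂ f (ball c R)) (hR : 0 < R) :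
    ∫ w in ball c R, f w = (π * R ^ 2 : ℝ) • f c := by
  -- Step 1: translate to the origin and write as an integral over `ℂ`
  have h1 : ∫ w in ball c R, f w
      = ∫ w, (ball (0:ℂ) R).indicator (fun w => f (c + w)) w := by
    rw [← integral_indicator measurableSet_ball,
      ← integral_add_left_eq_self (f := fun x => (ball c R).indicator f x) c]
    congr 1
    funext w
    simp only [indicator, mem_ball, dist_eq_norm, add_sub_cancel_left, sub_zero]
  -- Step 2: polar coordinates
  rw [h1, ← Complex.integral_comp_polarCoord_symm, polarCoord_target]
  -- Step 3: the integrand vanishes for `r ≥ R`; restrict to the box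
  have hmeas : MeasurableSet (Ioo (0:ℝ) R ×ˢ Ioo (-π) π) := measurableSet_Ioo.prod measurableSet_Ioo
  have hsub : Ioo (0:ℝ) R ×ˢ Ioo (-π) π ⊆ Ioi 0 ×ˢ Ioo (-π) π :=
    Set.prod_mono Ioo_subset_Ioi_self subset_rfl
  rw [setIntegral_eq_of_subset_of_forall_sdiff_eq_zero (measurableSet_Ioi.prod measurableSet_Ioo)
    hsub ?_]
  swap
  · intro p hp
    have hp1 : R ≤ p.1 := not_lt.mp fun h => hp.2 ⟨⟨hp.1.1, h⟩, hp.1.2⟩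
    have : Complex.polarCoord.symm p ∉ ball (0:ℂ) R := by
      rw [mem_ball, dist_zero_right, Complex.norm_polarCoord_symm, abs_of_pos (hR.trans_le hp1)]
      exact not_lt.mpr hp1
    simp only [indicator_of_notMem this, smul_zero]
  -- Step 4: on the box the indicator is the value and `c + polarCoord.symm p = circleMap`
  rw [setIntegral_congr_fun hmeas (g := fun p : ℝ × ℝ => p.1 • f (circleMap c p.1 p.2)) ?_]
  swap
  · intro p hp
    have : Complex.polarCoord.symm p ∈ ball (0:ℂ) R := by
      rw [mem_ball, dist_zero_right, Complex.norm_polarCoord_symm, abs_of_pos hp.1.1]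
      exact hp.1.2
    simp only [indicator_of_mem this, add_polarCoord_symm]
  -- Step 5: Fubini
  rw [Measure.volume_eq_prod, setIntegral_prod _ (by
    rw [← Measure.volume_eq_prod]; exact integrableOn_polar hf hR)]
  -- Step 6: the angular integral
  have h6 : ∀ r ∈ Ioo (0:ℝ) R,
      ∫ θ in Ioo (-π) π, r • f (circleMap c r θ) = r • ((2 * π : ℝ) • f c) := by
    intro r hr
    rw [integral_smul, integral_angle hf hr.1 hr.2]
  rw [setIntegral_congr_fun measurableSet_Ioo h6, integral_smul_const]
  -- Step 7: the radial integral `∫_0^R r dr = R²/2`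
  have h7 : ∫ r in Ioo (0:ℝ) R, r = R ^ 2 / 2 := by
    rw [← integral_Ioc_eq_integral_Ioo, ← intervalIntegral.integral_of_le hR.le, integral_id]
    ring
  rw [h7, smul_smul]
  congr 1
  ring

/-- **The `L²` mean value bound**: `‖f c‖² ≤ (πR²)⁻¹ ∫_{B(c,R)} ‖f‖²`. -/
theorem norm_sq_le_integral (hf : DiffContOnCl ℂ f (ball c R)) (hR : 0 < R) :
    ‖f c‖ ^ 2 ≤ (π * R ^ 2)⁻¹ * ∫ w in ball c R, ‖f w‖ ^ 2 := by
  have hcont : ContinuousOn f (closedBall c R) := by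
    simpa [closure_ball c hR.ne'] using hf.continuousOn
  obtain ⟨M, hM⟩ := (isCompact_closedBall c R).exists_bound_of_continuousOn hcont
  have hpos : 0 < π * R ^ 2 := by positivity
  -- `‖f c‖ ≤ (πR²)⁻¹ ∫ ‖f‖`
  have h1 : ‖f c‖ ≤ (π * R ^ 2)⁻¹ * ∫ w in ball c R, ‖f w‖ := by
    have : f c = (π * R ^ 2 : ℝ)⁻¹ • ∫ w in ball c R, f w := by
      rw [integral_ball_eq_pi_smul hf hR, smul_smul, inv_mul_cancel₀ hpos.ne', one_smul]
    rw [this, norm_smul, Real.norm_eq_abs, abs_of_pos (inv_pos.mpr hpos)]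
    exact mul_le_mul_of_nonneg_left (norm_integral_le_integral_norm _) (inv_pos.mpr hpos).le
  -- Cauchy–Schwarz: `(∫ ‖f‖)² ≤ vol · ∫ ‖f‖²`
  haveI : IsFiniteMeasure (volume.restrict (ball c R)) :=
    isFiniteMeasure_restrict.mpr measure_ball_lt_top.ne
  have hmeasf : AEStronglyMeasurable f (volume.restrict (ball c R)) :=
    (hcont.mono ball_subset_closedBall).aestronglyMeasurable measurableSet_ball
  have hmem : MemLp (fun w => ‖f w‖) (ENNReal.ofReal 2) (volume.restrict (ball c R)) := by
    refine MemLp.of_bound hmeasf.norm M ?_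
    refine ae_restrict_of_forall_mem measurableSet_ball fun w hw => ?_
    rw [norm_norm]
    exact hM w (ball_subset_closedBall hw)
  have hmem1 : MemLp (fun _ : ℂ => (1:ℝ)) (ENNReal.ofReal 2) (volume.restrict (ball c R)) :=
    memLp_const 1
  have hcs := integral_mul_le_Lp_mul_Lq_of_nonneg (μ := volume.restrict (ball c R))
    (p := 2) (q := 2) (Real.HolderConjugate.two_two)
    (Filter.Eventually.of_forall fun w => norm_nonneg (f w))
    (Filter.Eventually.of_forall fun _ => zero_le_one) hmem hmem1
  simp only [mul_one, one_rpow, integral_const, smul_eq_mul] at hcs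
  have hvol : (volume.restrict (ball c R)).real univ = π * R ^ 2 := by
    rw [measureReal_def, Measure.restrict_apply_univ, Complex.volume_ball, ENNReal.toReal_mul,
      ENNReal.toReal_pow, ENNReal.toReal_ofReal hR.le, ENNReal.coe_toReal, NNReal.coe_real_pi]
    ring
  have hA : 0 ≤ ∫ w in ball c R, ‖f w‖ ^ 2 := integral_nonneg fun w => by positivity
  -- assemble
  have hcs' : (∫ w in ball c R, ‖f w‖) ^ 2 ≤ (∫ w in ball c R, ‖f w‖ ^ 2) * (π * R ^ 2) := by
    rw [hvol] at hcs
    have hnn : 0 ≤ ∫ w in ball c R, ‖f w‖ := integral_nonneg fun w => norm_nonneg _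
    calc (∫ w in ball c R, ‖f w‖) ^ 2
        ≤ ((∫ w in ball c R, ‖f w‖ ^ 2) ^ (1 / 2 : ℝ) * (π * R ^ 2) ^ (1 / 2 : ℝ)) ^ 2 := by
          gcongr
          simpa [Real.rpow_natCast] using hcs
      _ = (∫ w in ball c R, ‖f w‖ ^ 2) * (π * R ^ 2) := by
          rw [mul_pow, ← Real.rpow_natCast, ← Real.rpow_natCast, ← Real.rpow_mul hA,
            ← Real.rpow_mul hpos.le]
          norm_num
  calc ‖f c‖ ^ 2 ≤ ((π * R ^ 2)⁻¹ * ∫ w in ball c R, ‖f w‖) ^ 2 := by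
        gcongr
    _ = (π * R ^ 2)⁻¹ ^ 2 * (∫ w in ball c R, ‖f w‖) ^ 2 := by ring
    _ ≤ (π * R ^ 2)⁻¹ ^ 2 * ((∫ w in ball c R, ‖f w‖ ^ 2) * (π * R ^ 2)) := by
        gcongr
    _ = (π * R ^ 2)⁻¹ * ∫ w in ball c R, ‖f w‖ ^ 2 := by
        field_simp

end Summit.Ventures.HodgeRepro2.DiscMeanValue
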